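import Summits.RiemannHypothesis.RiemannHypothesis.Theses.RuelleBand
import Summits.RiemannHypothesis.RiemannHypothesis.Theorems.RuelleBandExactFirstBandStubEvenEngineTransform
import HarnessLib.Audit

/-!
# Line `SketchIdeator1` (even Weil sector), engine part 2: a real exponential sum bounded below has no mode of positive real part

Crux `RuelleBand.ExactFirstBand` (stmt-RiemannHypothesis-2061), line SketchIdeator1, stub `stub_evenEngine` (THE ENGINE,
one-sided power-sum lemma).  Let `F(x) = Σᵢ cᵢ e^{λᵢ x}` with `Σ‖cᵢ‖ < ∞`, `Re λᵢ ≤ R`, `(λᵢ)` locally finite and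
no `λᵢ` on the open positive real axis.  If `F` is real and `≥ -M` on `x ≥ 0`, then for every `μ` with `Re μ > 0`
the coefficients on the fibre `{λᵢ = μ}` sum to `0`.

Proof.  By the analytic half (`stub_evenEngine_transform`, sibling file: Landau's theorem for the Mellin transform of
the non-negative function `y ↦ F(log y) + M`) there is `𝓜` holomorphic on `Re s > 0` with
`𝓜(s) - M/s = Σᵢ cᵢ/(s-λᵢ)` for `Re s > R₀ := max R 0`.  The rest is the pole-clearing / identity-theorem step of
the tree's `BoundedPowerSum.sum_fiber_eq_zero` VERBATIM (there the transform was holomorphic on `Re s > 0` because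
`F` was bounded; here because of Landau): on a thin convex neighbourhood `N` of the segment
`K = [μ, R₀ + 2 + i Im μ]`, the tail of the partial-fraction series over exponents off `K` is holomorphic, the
finitely many poles on `K` are cleared by a polynomial `q`, `q · (𝓜 - M/s - tail)` agrees with a polynomial `P` on
`N ∩ {Re s > R₀}` hence on `N`, and evaluating at `μ` gives `0 = P(μ) = (∏_{ν ≠ μ} (μ - ν)) · Σ_{λᵢ = μ} cᵢ`.
One-sidedness is paid for exactly by "no positive real mode" (`e^x (3 + 2 cos x) ≥ 0`).
-/

set_option linter.dupNamespace false

noncomputable section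

open Complex Filter Set MeasureTheory Metric
open scoped Real Topology

namespace Summit.RiemannHypothesis.RiemannHypothesis.Theorems.RuelleBandExactFirstBand

open Literature.NumberTheory.LFunctions
open Literature.Analysis.Complex

/-- **THE ENGINE of line `SketchIdeator1` (`stub_evenEngine`): a real exponential sum bounded below on `x ≥ 0`,
with locally finite exponents none of which lies on the open positive real axis, has no mode of positive real
part** — the coefficients on every fibre `{λᵢ = μ}`, `Re μ > 0`, sum to zero.  Landau (sibling file) makes the
transform holomorphic on `Re s > 0`; then pole clearing and the identity theorem as in
`BoundedPowerSum.sum_fiber_eq_zero`. [folklore] -/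
theorem stub_evenEngine :
    ∀ (ι : Type) [Countable ι] (c lam : ι → ℂ) (R M : ℝ),
      Summable (fun i => ‖c i‖) → (∀ i, (lam i).re ≤ R) →
      (∀ z : ℂ, ∃ ε > 0, {i | lam i ∈ Metric.ball z ε}.Finite) →
      (∀ i, 0 < (lam i).re → (lam i).im ≠ 0) →
      (∀ x : ℝ, 0 ≤ x → (∑' i, c i * cexp (lam i * x)).im = 0) →
      (∀ x : ℝ, 0 ≤ x → -M ≤ (∑' i, c i * cexp (lam i * x)).re) →
      ∀ μ : ℂ, 0 < μ.re → ∀ s : Finset ι, (∀ i, i ∈ s ↔ lam i = μ) → ∑ i ∈ s, c i = 0 := by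
  intro ι _ c lam R' M hc hR' hlf hax hreal hM μ hμ s hs
  classical
  -- normalise the abscissa bound to `R = max R' 0 ≥ 0`
  set R : ℝ := max R' 0 with hRdef
  have hR : ∀ i, (lam i).re ≤ R := fun i ↦ (hR' i).trans (le_max_left _ _)
  have hR0 : 0 ≤ R := le_max_right _ _
  -- the transform, holomorphic on `Re s > 0` (Landau), with its partial-fraction expansion on `Re s > R`
  obtain ⟨𝓜, h𝓜, hsum⟩ := stub_evenEngine_transform ι c lam R M hR0 hc hR hlf hax hreal hM
  -- trivial if the fibre is empty
  rcases s.eq_empty_or_nonempty with rfl | ⟨i₀, hi₀⟩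
  · simp
  have hμi₀ : lam i₀ = μ := (hs i₀).1 hi₀
  -- the segment `K = [μ, R + 2 + i Im μ]`
  set K : Set ℂ := {z | z.re ∈ Icc μ.re (R + 2) ∧ z.im = μ.im} with hK
  have hμR : μ.re ≤ R := hμi₀ ▸ hR i₀
  have hKc : IsCompact K := by
    have h : K = Icc μ.re (R + 2) ×ℂ {μ.im} := by
      ext z; simp [hK, Complex.mem_reProdIm]
    rw [h]
    exact isCompact_Icc.reProdIm isCompact_singleton
  have hKconv : Convex ℝ K := by
    have h : K = (Complex.reLm ⁻¹' Icc μ.re (R + 2)) ∩ (Complex.imLm ⁻¹' {μ.im}) := by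
      ext z; simp [hK]
    rw [h]
    exact ((convex_Icc _ _).linear_preimage _).inter ((convex_singleton _).linear_preimage _)
  have hμK : μ ∈ K := ⟨⟨le_rfl, by linarith⟩, rfl⟩
  set z₀ : ℂ := ⟨R + 2, μ.im⟩ with hz₀
  have hz₀K : z₀ ∈ K := ⟨⟨by simp [hz₀]; linarith, by simp [hz₀]⟩, by simp [hz₀]⟩
  have hz₀R : R < z₀.re := by simp [hz₀]
  -- indices with exponent on `K`: a finite set containing the fibre
  set I₀ : Finset ι := (BoundedPowerSum.finite_preimage_of_isCompact hlf hKc).toFinset with hI₀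
  have hmemI₀ : ∀ i, i ∈ I₀ ↔ lam i ∈ K := fun i ↦ by simp [hI₀]
  have hsI₀ : s ⊆ I₀ := fun i hi ↦ (hmemI₀ i).2 (((hs i).1 hi).symm ▸ hμK)
  have hi₀I₀ : i₀ ∈ I₀ := hsI₀ hi₀
  -- the other exponents stay away from `K`
  have hT : IsClosed (lam '' ((I₀ : Set ι)ᶜ)) := BoundedPowerSum.isClosed_image hlf _
  have hKT : K ⊆ (lam '' ((I₀ : Set ι)ᶜ))ᶜ := by
    rintro z hz ⟨i, hi, rfl⟩
    exact hi ((hmemI₀ i).2 hz)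
  obtain ⟨δ₀, hδ₀, hthick⟩ := hKc.exists_thickening_subset_open hT.isOpen_compl hKT
  set δ : ℝ := min δ₀ μ.re with hδdef
  have hδ : 0 < δ := lt_min hδ₀ hμ
  have hδ₀' : δ ≤ δ₀ := min_le_left _ _
  have hδμ : δ ≤ μ.re := min_le_right _ _
  -- the open convex neighbourhood `N` of `K`
  set N : Set ℂ := thickening (δ / 2) K with hN
  have hNo : IsOpen N := isOpen_thickening
  have hNconv : Convex ℝ N := hKconv.thickening _
  have hKN : K ⊆ N := self_subset_thickening (by positivity) K
  have hNre : ∀ z ∈ N, 0 < z.re := by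
    intro z hz
    obtain ⟨k, hk, hzk⟩ := mem_thickening_iff.1 hz
    have h1 : |z.re - k.re| < δ / 2 := by
      calc |z.re - k.re| = |(z - k).re| := by simp
        _ ≤ ‖z - k‖ := Complex.abs_re_le_norm _
        _ = dist z k := (dist_eq_norm z k).symm
        _ < δ / 2 := hzk
    have h2 : μ.re ≤ k.re := hk.1.1
    rw [abs_lt] at h1
    linarith
  have hNdist : ∀ z ∈ N, ∀ i, i ∉ I₀ → δ / 2 ≤ ‖z - lam i‖ := by
    intro z hz i hi
    obtain ⟨k, hk, hzk⟩ := mem_thickening_iff.1 hz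
    have hfar : lam i ∉ thickening δ₀ K := fun h ↦ hthick h ⟨i, hi, rfl⟩
    have h1 : δ₀ ≤ dist (lam i) k := by
      by_contra hlt
      exact hfar (mem_thickening_iff.2 ⟨k, hk, not_le.1 hlt⟩)
    have h2 : dist (lam i) k ≤ dist z (lam i) + dist z k := by
      rw [dist_comm z (lam i)]; exact dist_triangle _ _ _
    have h3 : dist z (lam i) = ‖z - lam i‖ := dist_eq_norm _ _
    linarith
  -- the tail `G₁` is holomorphic on `N`
  set G₁ : ℂ → ℂ := fun z ↦ ∑' i : ((I₀ : Set ι)ᶜ : Set ι), c i / (z - lam i) with hG₁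
  have hG₁d : DifferentiableOn ℂ G₁ N := by
    refine differentiableOn_tsum_of_summable_norm
      (u := fun i : ((I₀ : Set ι)ᶜ : Set ι) ↦ ‖c i‖ * (2 / δ))
      ((hc.subtype _).mul_right _) (fun i ↦ ?_) hNo fun i z hz ↦ ?_
    · refine DifferentiableOn.div (differentiableOn_const _) (by fun_prop) fun z hz h0 ↦ ?_
      have h := hNdist z hz i i.2
      rw [h0, norm_zero] at h
      linarith
    · rw [norm_div]
      have hzi := hNdist z hz i i.2
      have hpos : 0 < ‖z - lam i‖ := by linarith
      rw [div_le_iff₀ hpos]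
      calc ‖c ↑i‖ = ‖c i‖ * (2 / δ) * (δ / 2) := by field_simp
        _ ≤ ‖c i‖ * (2 / δ) * ‖z - lam ↑i‖ := by gcongr
  -- `Φ = 𝓜 - M/z - G₁` is holomorphic on `N`
  set Φ : ℂ → ℂ := fun z ↦ 𝓜 z - M / z - G₁ z with hΦ
  have hΦd : DifferentiableOn ℂ Φ N := by
    refine DifferentiableOn.sub (DifferentiableOn.sub (fun z hz ↦ ?_) (fun z hz ↦ ?_)) hG₁d
    · exact (h𝓜 z (hNre z hz)).mono_of_mem_nhdsWithin
        (mem_nhdsWithin_of_mem_nhds ((isOpen_lt continuous_const Complex.continuous_re).mem_nhds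
          (hNre z hz)))
    · exact ((differentiableAt_const _).div differentiableAt_id (fun h ↦ by
        have := hNre z hz; rw [h, zero_re] at this; exact lt_irrefl _ this)).differentiableWithinAt
  -- the polynomial `q` clearing the finitely many poles on `K`, and `P = q · (finite part)`
  set V : Finset ℂ := I₀.image lam with hV
  set q : ℂ → ℂ := fun z ↦ ∏ ν ∈ V, (z - ν) with hq
  set P : ℂ → ℂ := fun z ↦ ∑ i ∈ I₀, c i * ∏ ν ∈ V.erase (lam i), (z - ν) with hP
  have hqd : Differentiable ℂ q := by
    simp only [hq]
    fun_prop
  have hPd : Differentiable ℂ P := by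
    simp only [hP]
    fun_prop
  -- on `N ∩ {Re z > R}` we have `q Φ = P`
  have hEq : ∀ z ∈ N, R < z.re → q z * Φ z = P z := by
    intro z _ hzR
    have hne : ∀ i, z - lam i ≠ 0 := fun i h ↦ by
      have h' := congrArg Complex.re h
      simp only [sub_re, zero_re] at h'
      linarith [hR i]
    have h1 : Φ z = ∑ i ∈ I₀, c i / (z - lam i) := by
      simp only [hΦ, hG₁]
      rw [← (hsum z hzR).tsum_eq, ← (hsum z hzR).summable.sum_add_tsum_compl (s := I₀)]
      ring
    rw [h1, Finset.mul_sum]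
    refine Finset.sum_congr rfl fun i hi ↦ ?_
    have hiV : lam i ∈ V := Finset.mem_image_of_mem lam hi
    simp only [hq]
    rw [← Finset.mul_prod_erase V (fun ν ↦ z - ν) hiV, mul_assoc, mul_comm (z - lam i),
      mul_assoc, div_mul_cancel₀ _ (hne i), mul_comm]
  -- identity theorem on the convex open set `N`
  have hEqOn : EqOn (fun z ↦ q z * Φ z) P N := by
    refine ((hqd.differentiableOn.mul hΦd).analyticOnNhd hNo).eqOn_of_preconnected_of_eventuallyEq
      (hPd.differentiableOn.analyticOnNhd hNo) hNconv.isPreconnected (hKN hz₀K) ?_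
    filter_upwards [hNo.mem_nhds (hKN hz₀K),
      (isOpen_lt continuous_const Complex.continuous_re).mem_nhds hz₀R] with z hz hzR
    exact hEq z hz hzR
  -- evaluate at `μ`
  have hμV : μ ∈ V := hμi₀ ▸ Finset.mem_image_of_mem lam hi₀I₀
  have hqμ : q μ = 0 := by
    simp only [hq]
    exact Finset.prod_eq_zero hμV (sub_self μ)
  have hPμ : P μ = 0 := by
    rw [← hEqOn (hKN hμK)]
    simp only [hqμ, zero_mul]
  -- compute `P μ = D · ∑_{i ∈ s} cᵢ` with `D ≠ 0`
  set D : ℂ := ∏ ν ∈ V.erase μ, (μ - ν) with hD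
  have hD0 : D ≠ 0 :=
    Finset.prod_ne_zero_iff.2 fun ν hν ↦ sub_ne_zero.2 (Finset.ne_of_mem_erase hν).symm
  have hPμ' : P μ = D * ∑ i ∈ s, c i := by
    simp only [hP]
    rw [Finset.mul_sum, ← Finset.sum_subset hsI₀]
    · refine Finset.sum_congr rfl fun i hi ↦ ?_
      rw [(hs i).1 hi, mul_comm]
    · intro i _ his
      have hne : lam i ≠ μ := fun h ↦ his ((hs i).2 h)
      have hμVi : μ ∈ V.erase (lam i) := Finset.mem_erase.2 ⟨hne.symm, hμV⟩
      rw [Finset.prod_eq_zero hμVi (sub_self μ), mul_zero]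
  rw [hPμ', mul_eq_zero] at hPμ
  exact hPμ.resolve_left hD0

end Summit.RiemannHypothesis.RiemannHypothesis.Theorems.RuelleBandExactFirstBand

end
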